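import Mathlib
import HarnessLib

/-!
# Symplectic modules I: the hyperbolic plane through an element of maximal order

Pure algebra (topic `Literature/GroupTheory/FiniteAbelian`). A *symplectic module* (Tignol–Amitsur)
is a finite abelian group `T` with a bi-additive pairing `B : T × T → ℚ/ℤ` which is alternating
(`B(x, x) = 0`) and nondegenerate. This file proves the two lemmas from which the structure theorem
`T ≃ L × L` (sequel `SymplecticModules.lean`) follows by induction on `#T`:

* `exists_apply_eq_coe_one_div` — **the partner of an element**: if `x ∈ T` has order `n`, some
  `y ∈ T` has `B(x, y) = 1/n` (nondegeneracy makes `t ↦ B(t, ·)` injective, so the character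
  `B(x, ·)` has order `n`; its values are multiples `a/n` of `1/n` and the numerators form a subgroup
  `dℤ ≤ ℤ` with `(n/d) · B(x, ·) = 0`, whence `d = ±1`);
* `isCompl_hyperbolicPlane` — **Wall's Lemma 1 for the plane `H = ⟨x⟩ + ⟨y⟩`**: if
  `n x = n y = 0` and `B(x, y) = 1/n` then `⟨x⟩ ∩ ⟨y⟩ = 0` and `T = H ⊕ H^⊥`,
  `H^⊥ = ker B(·, x) ∩ ker B(·, y)`, explicitly `t = (a x - b y) + (t - a x + b y)` with
  `B(t, y) = a/n`, `B(t, x) = b/n`; and `nondegenerate_restrict_of_codisjoint` — `B` stays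
  nondegenerate on `H^⊥`.

Printed sources: C. T. C. Wall, *Quadratic forms on finite groups, and related topics*, Topology 2
(1963) 281–298, Lemma 1 (`|B| · |B^⊥| = |A|`, `A = B ⊥ B^⊥` for a nondegenerate subgroup `B`) and
the proof of Lemma 7; J.-P. Tignol, S. A. Amitsur, *Symplectic modules*, Israel J. Math. 54 (1986)
266–290, Prop. 2.2 (quoted from the held text arXiv:1604.07227, §2 Prop. 1: "`|B||B^⊥| = |A|` and
`(B^⊥)^⊥ = B`. If the induced submodule on `B` … is a symplectic module then … `A = B ⊕^⊥ B^⊥`.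
See proposition 2.2 of [A-T2] or lemma 1 in [Wal]").

Design, as in `AlternatingPairing.lean`: `ℚ/ℤ` is `AddCircle (1 : ℚ)`, pairings are curried
`T →+ T →+ _`, nondegeneracy is stated on the left, orthogonal complements are spelled with
Mathlib's `AddMonoidHom.ker` of `B.flip s`; theorems only, no definitions, no number theory
imported, no named fact introduced (D-0026).
-/

noncomputable section

open AddSubgroup

namespace Literature.GroupTheory.FiniteAbelian

universe u v

/-! ### Generalities on alternating pairings (any value group) -/

section General

variable {T : Type u} [AddCommGroup T] {Q : Type v} [AddCommGroup Q]

/-- An alternating bi-additive pairing is antisymmetric: `B(x, y) = -B(y, x)`. [folklore] -/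
private theorem apply_eq_neg_apply_of_alternating (B : T →+ T →+ Q) (halt : ∀ x, B x x = 0) (x y : T) :
    B x y = -B y x := by
  have h := halt (x + y)
  simp only [map_add, AddMonoidHom.add_apply, halt x, halt y, zero_add, add_zero] at h
  exact eq_neg_of_add_eq_zero_right h

end General

/-! ### `ℚ/ℤ = AddCircle (1 : ℚ)`: `n`-torsion values are multiples of `1/n` -/

section Circle

/-- The class of `1/n` in `ℚ/ℤ` has order `n` (`n ≥ 1`). [folklore] -/
private theorem addOrderOf_coe_one_div {n : ℕ} (hn : 0 < n) :
    addOrderOf ((((1 : ℚ) / n : ℚ)) : AddCircle (1 : ℚ)) = n :=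
  AddCircle.addOrderOf_period_div hn

/-- An `n`-torsion element of `ℚ/ℤ` is an integer multiple of the class of `1/n`. [folklore] -/
private theorem exists_eq_zsmul_coe_one_div {n : ℕ} (hn : 0 < n) {q : AddCircle (1 : ℚ)}
    (hq : n • q = 0) : ∃ a : ℤ, q = a • ((((1 : ℚ) / n : ℚ)) : AddCircle (1 : ℚ)) := by
  rw [AddCircle.nsmul_eq_zero_iff hn] at hq
  obtain ⟨m, -, rfl⟩ := hq
  refine ⟨m, ?_⟩
  rw [← AddCircle.coe_zsmul, zsmul_eq_mul, Int.cast_natCast, mul_one, mul_one_div]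

/-- `a • (1/n) = 0` in `ℚ/ℤ` iff `n ∣ a`. [folklore] -/
private theorem zsmul_coe_one_div_eq_zero_iff {n : ℕ} (hn : 0 < n) (a : ℤ) :
    a • ((((1 : ℚ) / n : ℚ)) : AddCircle (1 : ℚ)) = 0 ↔ (n : ℤ) ∣ a := by
  rw [← addOrderOf_dvd_iff_zsmul_eq_zero, addOrderOf_coe_one_div hn]

end Circle

/-! ### Symplectic modules: the hyperbolic plane through an element of maximal order -/

section Symplectic

variable {T : Type u} [AddCommGroup T]

/-- Nondegeneracy (on the left) makes `t ↦ B(t, ·)` injective. [folklore] -/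
private theorem injective_of_nondegenerate {Q : Type v} [AddCommGroup Q] (B : T →+ T →+ Q)
    (hnd : ∀ x, (∀ y, B x y = 0) → x = 0) : Function.Injective B := by
  intro a b hab
  have h0 : B (a - b) = 0 := by rw [map_sub, hab, sub_self]
  exact sub_eq_zero.mp (hnd _ fun y ↦ by rw [h0, AddMonoidHom.zero_apply])

/-- A value `B(t, y)` with `n • y = 0` is an integer multiple of `1/n`. [folklore] -/
private theorem exists_apply_eq_zsmul_right (B : T →+ T →+ AddCircle (1 : ℚ)) {n : ℕ} (hn : 0 < n)
    {y : T} (hy : n • y = 0) (t : T) :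
    ∃ a : ℤ, B t y = a • ((((1 : ℚ) / n : ℚ)) : AddCircle (1 : ℚ)) :=
  exists_eq_zsmul_coe_one_div hn (by rw [← map_nsmul, hy, map_zero])

/-- A value `B(x, t)` with `n • x = 0` is an integer multiple of `1/n`. [folklore] -/
private theorem exists_apply_eq_zsmul_left (B : T →+ T →+ AddCircle (1 : ℚ)) {n : ℕ} (hn : 0 < n)
    {x : T} (hx : n • x = 0) (t : T) :
    ∃ a : ℤ, B x t = a • ((((1 : ℚ) / n : ℚ)) : AddCircle (1 : ℚ)) :=
  exists_eq_zsmul_coe_one_div hn (by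
    rw [show n • B x t = (n • B x) t from rfl, ← map_nsmul, hx, map_zero, AddMonoidHom.zero_apply])

/-- **The partner of an element under a nondegenerate pairing.** If `B : T × T → ℚ/ℤ` is
nondegenerate on the finite abelian group `T` and `x ∈ T` has order `n`, some `y ∈ T` has
`B(x, y) = 1/n`: the character `B(x, ·)` has order `n` (nondegeneracy), its values are multiples
`a/n` of `1/n`, and the numerators `a` form a subgroup `dℤ` of `ℤ` with `(n/d) · B(x, ·) = 0`, so
`d = ±1`. (Wall 1963, proof of Lemma 7; Tignol–Amitsur 1986, proof of Thm. 4.1.)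
[cite: Wall1963QuadraticFormsFiniteGroups, Lemma 7] -/
theorem exists_apply_eq_coe_one_div [Finite T] (B : T →+ T →+ AddCircle (1 : ℚ))
    (hnd : ∀ x, (∀ y, B x y = 0) → x = 0) (x : T) :
    ∃ y : T, B x y = ((((1 : ℚ) / addOrderOf x : ℚ)) : AddCircle (1 : ℚ)) := by
  set n : ℕ := addOrderOf x with hn_def
  have hn : 0 < n := addOrderOf_pos x
  set u : AddCircle (1 : ℚ) := ((((1 : ℚ) / n : ℚ)) : AddCircle (1 : ℚ)) with hu_def
  have hordB : addOrderOf (B x) = n := addOrderOf_injective B (injective_of_nondegenerate B hnd) x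
  have hval : ∀ t, ∃ a : ℤ, B x t = a • u := fun t ↦
    exists_apply_eq_zsmul_left B hn (addOrderOf_nsmul_eq_zero x) t
  -- the subgroup of numerators
  let S : AddSubgroup ℤ :=
    { carrier := {a : ℤ | ∃ t, B x t = a • u}
      zero_mem' := ⟨0, by rw [map_zero, zero_zsmul]⟩
      add_mem' := by
        rintro a b ⟨t, ht⟩ ⟨t', ht'⟩
        exact ⟨t + t', by rw [map_add, ht, ht', add_zsmul]⟩
      neg_mem' := by
        rintro a ⟨t, ht⟩
        exact ⟨-t, by rw [map_neg, ht, neg_zsmul]⟩ }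
  obtain ⟨d, hd⟩ := Int.subgroup_cyclic S
  have hmemS : ∀ {a : ℤ}, a ∈ S ↔ ∃ t, B x t = a • u := fun {a} ↦ Iff.rfl
  -- `n ∈ S` (value `0 = n • u`), so `d ∣ n`, `d ≠ 0`
  have hnS : (n : ℤ) ∈ S := hmemS.mpr ⟨0, by
    rw [map_zero, eq_comm, zsmul_coe_one_div_eq_zero_iff hn]⟩
  rw [hd, AddSubgroup.mem_closure_singleton] at hnS
  obtain ⟨m, hm⟩ := hnS
  -- hm : m • d = n
  rw [smul_eq_mul] at hm
  -- every value is `(k * d) • u`, so `m • B x = 0`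
  have hkill : m • B x = 0 := by
    ext t
    obtain ⟨a, ha⟩ := hval t
    have haS : a ∈ S := hmemS.mpr ⟨t, ha⟩
    rw [hd, AddSubgroup.mem_closure_singleton] at haS
    obtain ⟨k, hk⟩ := haS
    rw [smul_eq_mul] at hk
    rw [show (m • B x) t = m • B x t from rfl, ha, ← hk, smul_smul, AddMonoidHom.zero_apply,
      zsmul_coe_one_div_eq_zero_iff hn, ← hm]
    exact ⟨k, by ring⟩
  have hdvd : (n : ℤ) ∣ m := by
    rw [← hordB, addOrderOf_dvd_iff_zsmul_eq_zero]
    exact hkill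
  -- `n ∣ m` and `m * d = n` with `n > 0` force `d = ±1`
  have hm0 : m ≠ 0 := by
    rintro rfl
    rw [zero_mul] at hm
    exact absurd hm (by exact_mod_cast hn.ne)
  have hd1 : d = 1 ∨ d = -1 := by
    rcases hdvd with ⟨c, hc⟩
    -- n = m * d = n * c * d, so c * d = 1
    have hn0 : (n : ℤ) ≠ 0 := by exact_mod_cast hn.ne'
    have hcd : c * d = 1 := by
      have : (n : ℤ) * (c * d) = (n : ℤ) * 1 := by rw [mul_one, ← mul_assoc, ← hc, hm]
      exact mul_left_cancel₀ hn0 this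
    rcases Int.eq_one_or_neg_one_of_mul_eq_one' (by rwa [mul_comm] at hcd) with ⟨rfl, -⟩ | ⟨rfl, -⟩
    · exact Or.inl rfl
    · exact Or.inr rfl
  -- hence `1 ∈ S`
  have h1S : (1 : ℤ) ∈ S := by
    rw [hd, AddSubgroup.mem_closure_singleton]
    rcases hd1 with rfl | rfl
    · exact ⟨1, by rw [smul_eq_mul, mul_one]⟩
    · exact ⟨-1, by rw [smul_eq_mul]; norm_num⟩
  obtain ⟨y, hy⟩ := hmemS.mp h1S
  exact ⟨y, by rw [hy, one_zsmul]⟩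

variable (B : T →+ T →+ AddCircle (1 : ℚ))

/-- **The hyperbolic plane** (Wall 1963, Lemma 1 for `H = ⟨x, y⟩`): if `B` is alternating,
`n x = n y = 0` and `B(x, y) = 1/n`, then `⟨x⟩ ∩ ⟨y⟩ = 0` and
`T = (⟨x⟩ + ⟨y⟩) ⊕ H^⊥` with `H^⊥ = ker B(·, x) ∩ ker B(·, y)`: explicitly
`t = (a x - b y) + (t - a x + b y)` where `B(t, y) = a/n`, `B(t, x) = b/n`.
[cite: Wall1963QuadraticFormsFiniteGroups, Lemma 1] -/
theorem isCompl_hyperbolicPlane (halt : ∀ x, B x x = 0) {x y : T} {n : ℕ} (hn : 0 < n)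
    (hx : n • x = 0) (hy : n • y = 0)
    (hxy : B x y = ((((1 : ℚ) / n : ℚ)) : AddCircle (1 : ℚ))) :
    Disjoint (zmultiples x) (zmultiples y) ∧
      IsCompl (zmultiples x ⊔ zmultiples y) ((B.flip x).ker ⊓ (B.flip y).ker) := by
  set u : AddCircle (1 : ℚ) := ((((1 : ℚ) / n : ℚ)) : AddCircle (1 : ℚ)) with hu_def
  have hyx : B y x = -u := by rw [apply_eq_neg_apply_of_alternating B halt, hxy]
  have hmemHp : ∀ t, t ∈ (B.flip x).ker ⊓ (B.flip y).ker ↔ B t x = 0 ∧ B t y = 0 := fun t ↦ by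
    rw [AddSubgroup.mem_inf, AddMonoidHom.mem_ker, AddMonoidHom.mem_ker, AddMonoidHom.flip_apply,
      AddMonoidHom.flip_apply]
  -- multiples of `x`, `y` detected by `u`
  have hkx : ∀ k : ℤ, k • u = 0 → k • x = 0 := fun k hk ↦ by
    obtain ⟨c, rfl⟩ := (zsmul_coe_one_div_eq_zero_iff hn k).mp hk
    rw [mul_comm, mul_zsmul, natCast_zsmul, hx, zsmul_zero]
  have hky : ∀ k : ℤ, k • u = 0 → k • y = 0 := fun k hk ↦ by
    obtain ⟨c, rfl⟩ := (zsmul_coe_one_div_eq_zero_iff hn k).mp hk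
    rw [mul_comm, mul_zsmul, natCast_zsmul, hy, zsmul_zero]
  -- `B` on combinations `k x + m y`
  have hBx : ∀ k m : ℤ, B (k • x + m • y) x = -(m • u) := fun k m ↦ by
    rw [map_add, AddMonoidHom.add_apply, map_zsmul, map_zsmul, AddMonoidHom.zsmul_apply,
      AddMonoidHom.zsmul_apply, halt x, hyx, smul_zero, zero_add, smul_neg]
  have hBy : ∀ k m : ℤ, B (k • x + m • y) y = k • u := fun k m ↦ by
    rw [map_add, AddMonoidHom.add_apply, map_zsmul, map_zsmul, AddMonoidHom.zsmul_apply,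
      AddMonoidHom.zsmul_apply, halt y, hxy, smul_zero, add_zero]
  -- elements of `H = ⟨x⟩ + ⟨y⟩`
  have hmemH : ∀ h, h ∈ zmultiples x ⊔ zmultiples y ↔ ∃ k m : ℤ, k • x + m • y = h := fun h ↦ by
    rw [AddSubgroup.mem_sup]
    constructor
    · rintro ⟨a, ha, b, hb, rfl⟩
      rw [AddSubgroup.mem_zmultiples_iff] at ha hb
      obtain ⟨k, rfl⟩ := ha
      obtain ⟨m, rfl⟩ := hb
      exact ⟨k, m, rfl⟩
    · rintro ⟨k, m, rfl⟩
      exact ⟨k • x, AddSubgroup.zsmul_mem _ (AddSubgroup.mem_zmultiples x) k, m • y,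
        AddSubgroup.zsmul_mem _ (AddSubgroup.mem_zmultiples y) m, rfl⟩
  have hdisj : Disjoint (zmultiples x) (zmultiples y) := by
    rw [AddSubgroup.disjoint_def]
    intro z hzx hzy
    rw [AddSubgroup.mem_zmultiples_iff] at hzx hzy
    obtain ⟨k, rfl⟩ := hzx
    obtain ⟨m, hm⟩ := hzy
    -- `B(x, k x) = 0` and `B(x, m y) = m u`
    have h : m • u = 0 := by
      rw [← hxy, ← map_zsmul (B x), hm, map_zsmul, halt x, smul_zero]
    rw [← hm]
    exact hky m h
  refine ⟨hdisj, isCompl_iff.mpr ⟨?_, ?_⟩⟩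
  · -- `H ∩ H^⊥ = 0`
    rw [AddSubgroup.disjoint_def]
    intro h hH hHp
    obtain ⟨k, m, rfl⟩ := (hmemH h).mp hH
    obtain ⟨h1, h2⟩ := (hmemHp _).mp hHp
    rw [hBx, neg_eq_zero] at h1
    rw [hBy] at h2
    rw [hkx k h2, hky m h1, add_zero]
  · -- `H + H^⊥ = T`
    rw [codisjoint_iff, eq_top_iff]
    intro t _
    obtain ⟨a, ha⟩ := exists_apply_eq_zsmul_right B hn hy t
    obtain ⟨b, hb⟩ := exists_apply_eq_zsmul_right B hn hx t
    have hw : t - (a • x + (-b) • y) ∈ (B.flip x).ker ⊓ (B.flip y).ker := by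
      rw [hmemHp, map_sub, AddMonoidHom.sub_apply, AddMonoidHom.sub_apply, hBx, hBy, hb, ha,
        neg_zsmul, neg_neg, sub_self, sub_self]
      exact ⟨rfl, rfl⟩
    have : t = (a • x + (-b) • y) + (t - (a • x + (-b) • y)) := by abel
    rw [this]
    exact AddSubgroup.add_mem_sup ((hmemH _).mpr ⟨a, -b, rfl⟩) hw

/-- The plane `H = ⟨x⟩ + ⟨y⟩` is orthogonal to `H^⊥ = ker B(·, x) ∩ ker B(·, y)`. [folklore] -/
private theorem apply_eq_zero_of_mem_orthogonal_plane {Q : Type v} [AddCommGroup Q] (B : T →+ T →+ Q)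
    {x y : T} {s h : T} (hs : s ∈ (B.flip x).ker ⊓ (B.flip y).ker)
    (hh : h ∈ zmultiples x ⊔ zmultiples y) : B s h = 0 := by
  rw [AddSubgroup.mem_inf, AddMonoidHom.mem_ker, AddMonoidHom.mem_ker, AddMonoidHom.flip_apply,
    AddMonoidHom.flip_apply] at hs
  rw [AddSubgroup.mem_sup] at hh
  obtain ⟨a, ha, b, hb, rfl⟩ := hh
  rw [AddSubgroup.mem_zmultiples_iff] at ha hb
  obtain ⟨k, rfl⟩ := ha
  obtain ⟨m, rfl⟩ := hb
  rw [map_add, map_zsmul, map_zsmul, hs.1, hs.2, smul_zero, smul_zero, add_zero]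

/-- **Wall's Lemma 1, nondegeneracy half**: if `H + S = T` and `B(S, H) = 0`, then a pairing
nondegenerate on `T` stays nondegenerate on `S`. [cite: Wall1963QuadraticFormsFiniteGroups, Lemma 1] -/
theorem nondegenerate_restrict_of_codisjoint {Q : Type v} [AddCommGroup Q] (B : T →+ T →+ Q)
    (hnd : ∀ x, (∀ y, B x y = 0) → x = 0) {H S : AddSubgroup T} (hHS : Codisjoint H S)
    (horth : ∀ s ∈ S, ∀ h ∈ H, B s h = 0) :
    ∀ z : S, (∀ w : S, (B.comp S.subtype).compl₂ S.subtype z w = 0) → z = 0 := by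
  intro z hz
  have hz' : ∀ t : T, B z t = 0 := fun t ↦ by
    have ht : t ∈ H ⊔ S := by rw [hHS.eq_top]; exact AddSubgroup.mem_top t
    obtain ⟨h, hh, w, hw, rfl⟩ := AddSubgroup.mem_sup.mp ht
    have h1 : B z w = 0 := by simpa using hz ⟨w, hw⟩
    rw [map_add, horth z z.2 h hh, h1, add_zero]
  exact Subtype.ext (hnd z hz')

/-- **Wall's Lemma 1 for the hyperbolic plane**: with `x, y` as in `isCompl_hyperbolicPlane` and
`B` nondegenerate on `T`, the restriction of `B` to `H^⊥ = ker B(·, x) ∩ ker B(·, y)` is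
nondegenerate ("if the induced submodule on `B` is a symplectic module then the induced submodule
on `B^⊥` is also a symplectic module"). [cite: Wall1963QuadraticFormsFiniteGroups, Lemma 1]
[cite: TignolAmitsur1986SymplecticModules, Prop. 2.2] -/
theorem nondegenerate_restrict_hyperbolicPlane (halt : ∀ x, B x x = 0)
    (hnd : ∀ x, (∀ y, B x y = 0) → x = 0) {x y : T} {n : ℕ} (hn : 0 < n) (hx : n • x = 0)
    (hy : n • y = 0) (hxy : B x y = ((((1 : ℚ) / n : ℚ)) : AddCircle (1 : ℚ))) :
    ∀ z : ↥((B.flip x).ker ⊓ (B.flip y).ker), (∀ w : ↥((B.flip x).ker ⊓ (B.flip y).ker),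
      (B.comp ((B.flip x).ker ⊓ (B.flip y).ker).subtype).compl₂
        ((B.flip x).ker ⊓ (B.flip y).ker).subtype z w = 0) → z = 0 :=
  nondegenerate_restrict_of_codisjoint B hnd (isCompl_hyperbolicPlane B halt hn hx hy hxy).2.codisjoint
    fun _ hs _ hh ↦ apply_eq_zero_of_mem_orthogonal_plane B hs hh

end Symplectic

end Literature.GroupTheory.FiniteAbelian

end
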